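/-
COR-CM (cell pub-hodgecm2, stage 2 of the Hodge ladder) — PLANNER-D «delrec» row ii-c «LOCAL» edition (seat delrec-p6; OFFERED, files only on
PLANNER-D's word): the hDel′ display edition of the END `Summit.HodgeConjecture.CorCM.D2Bridge.MuKeyEnd.hc_cm_of_printed_citations_muKey`
(`Summits.HodgeConjecture.CorCM.D2Bridge.ClosedPrintedMuKey`, ✔ p375090, source sha16 4c4da85aea5c8bb1 :244) that needs NO hub olean of ✔ B1
`Literature/AlgebraicGeometry/ShimuraVarieties/UnitaryShimuraCanonicalModelPrintedForm.lean` (p375397; olean absent since 03:52Z 2026-08-24):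
binder 1 `hDel'` is displayed as the BODY of B1's `UnitaryCanonicalModel.canonicalModel_exists_form` (tree 7891b98d2741f1b2 :123–:132) with every
name fully qualified — [Deligne 1979] 2.2.5 + Cor. 2.7.21 AS PRINTED: «`M_ℂ(G,X)` admits a form over `E(G,X) = τ(L)` on which the Galois group acts
at the [diagonal] special points through 2.2.4» = [Milne 2005] (62), NO smoothness ∕ projectivity clause —, and `h := DelRec.exists_recordSystem_of_printed
(canonicalModel_exists_printed_of_form hDel')` is supplied INSIDE, where `canonicalModel_exists_printed_of_form` (§0 of this file) is B1's
`canonicalModel_exists_printed_iff_form.mpr` RE-PROVED LOCALLY from a LOCAL RE-DERIVATION of B1's descent theorems (one conjunction `smooth_and_projective_of_form`, proof steps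
= B1 :55–:120; the same device as ✔ S1b′ `DelRec/PrintedOfRecordSystemLocal.lean`).  Rows 2–7 (`h21 ∕ hLiuC ∕ h411 ∕ h413 ∕ hμsep ∕ hD1''`) are the
source bytes :246–:286 under the single textual substitution `h ↦ (Summit.HodgeConjecture.CorCM.DelRec.exists_recordSystem_of_printed
(Summit.HodgeConjecture.CorCM.D2Bridge.MuKeyEndDelRecFormLocal.canonicalModel_exists_printed_of_form hDel'))` (12 sites: h21 0 · hLiuC 2 · h411 1 ·
h413 1 · hμsep 7 · hD1'' 1) — i.e. the filed DIRECT edition p376562 (8269744617525a6c) with its composite term re-routed through §0; the proof is ONE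
application of the source theorem.  Every direct import of this file HAS a hub olean (✔ MuKey, ✔ S1a, and two long-built Literature modules).
GENERATED by script from the tree bytes, not hand-copied.  THEOREMS ONLY; nothing landed is edited or restated as a definition; new names in a new namespace.
FRAMING: HC_CM is NOT proved unconditionally (the displayed citations are hypotheses); this file claims no pointer ∕ label ∕ count move.
-/
import Summits.HodgeConjecture.CorCM.D2Bridge.ClosedPrintedMuKey
import Summits.HodgeConjecture.CorCM.DelRec.RecordSystemOfPrinted
import Literature.AlgebraicGeometry.HodgeTheory.AlgebraicCyclesDefinedOverQbarSpread
import Literature.AlgebraicGeometry.Motives.ProjectiveDescentProofs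
import HarnessLib

/-!
# hDel′ («form + (62)», formula display) edition of `Summit.HodgeConjecture.CorCM.D2Bridge.MuKeyEnd.hc_cm_of_printed_citations_muKey`, olean-local

* §0 `smooth_and_projective_of_form` — LOCAL RE-DERIVATION (one conjunction, this namespace) of ✔ B1's two descent theorems
  `smoothOfRelativeDimension_of_form` ∕ `isProjectiveOver_of_form` (EGA IV₄ 17.7.4; Görtz–Wedhorn I 14.57 = tree `Motives.IsProjectiveOver.of_baseChange_holds`),
  proof steps = `UnitaryShimuraCanonicalModelPrintedForm.lean` :55–:120 (B1's module is not importable until its hub olean exists); `canonicalModel_exists_printed_of_form` — B1's `canonicalModel_exists_printed_iff_form.mpr`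
  with its hypothesis spelled as B1's formula (names fully qualified); `form_iff_canonicalModel_exists_printed` — the displayed formula `↔` row L1's
  `canonicalModel_exists_printed` (kernel, by import of ✔ L1).
* `hc_cm_of_printed_citations_muKey_delRecFormLocal` — the source END at `h := DelRec.exists_recordSystem_of_printed (canonicalModel_exists_printed_of_form hDel')`.
  DISPLAYED: `hDel'` = the formula of [Deligne 1979] 2.2.5 + Cor. 2.7.21 AS PRINTED at the datum `(Res_{L⁺/ℚ} U(H), 𝔹²)` (B1's body; kernel-identical
  to `UnitaryCanonicalModel.canonicalModel_exists_form` by `Iff.rfl` once B1's olean exists) and, VERBATIM from the source up to the substitution of `h`,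
  `h21 ∕ hLiuC ∕ h411 ∕ h413 ∕ hμsep ∕ hD1''`.  0 data binders.  HC_CM is NOT proved unconditionally; nothing displayed is inhabited here.
[Deligne1979ShimuraVarieties] 2.1.2–2.1.4, 2.2.4–2.2.5, Cor. 2.7.21; [Milne2005ShimuraVarieties] Def. 12.8 (62), Def. 12.10.
-/

set_option autoImplicit false

noncomputable section

namespace Summit.HodgeConjecture.CorCM.D2Bridge.MuKeyEndDelRecFormLocal

/-! ## §0. Local copies of ✔ B1's descent theorems and of `canonicalModel_exists_printed_iff_form.mpr` (B1's hub olean is absent) -/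

section LocalDescent

open Function MulAction Topology NumberField IsDedekindDomain CategoryTheory CategoryTheory.Limits Matrix AlgebraicGeometry
open scoped Matrix ComplexOrder
open Literature.AlgebraicGeometry Literature.AlgebraicGeometry.Motives
open Literature.NumberTheory.Automorphic Literature.NumberTheory.Automorphic.UnitaryGroup
open Literature.NumberTheory.Automorphic.Liu2021.AppendixC (C5.OpenCompactSubgroup C5.SmallLevel)
open Literature.Geometry.ComplexHyperbolic Literature.Geometry.ComplexHyperbolic.BallModel
open Literature.NumberTheory.Automorphic.ShimuraDissection
open Literature.AlgebraicGeometry.ShimuraVarieties Literature.AlgebraicGeometry.ShimuraVarieties.UnitaryCanonicalModel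

variable {L : Type} [Field L] [NumberField L] [IsCMField L] {H : Matrix (Fin 3) (Fin 3) L} {τ : L →+* ℂ}
  {T : GL (Fin 3) ℂ} {hT : formCongr (starRingEnd ℂ) T (H.map τ) = BallModel.J}
  {K₀ : C5.OpenCompactSubgroup ↥(finAdelic (↥(maximalRealSubfield L)) L (IsCMField.complexConj L) 3 H)}

/-- **LOCAL RE-DERIVATION of ✔ B1's two descent theorems** (`UnitaryCanonicalModel.smoothOfRelativeDimension_of_form` and
`….isProjectiveOver_of_form` of `UnitaryShimuraCanonicalModelPrintedForm.lean`, p375397 — that module cannot be imported here until its hub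
olean exists; when it does, this conjunction is literally `⟨smoothOfRelativeDimension_of_form Sc M e K, isProjectiveOver_of_form Sc M e K⟩`):
the models `M_K` of an `L`-form `e : M ⊗_{L,τ} ℂ ≅ Sc.Mc` of a complex record system are smooth of relative dimension `2` over `L` AND projective
over `L` — `(M_K)_τ ≅ Sc.Mc_K` is smooth of relative dimension `2` and projective over `ℂ` (clauses (C1) of `Sc`; both properties respect
isomorphisms of `ℂ`-schemes), smoothness descends along the fpqc cover `Spec ℂ → Spec L` (Mathlib `Smooth` `descendsAlong` surjective-flat-qc,
EGA IV₄ 17.7.4) with its relative dimension (tree `HodgeTheory.smoothOfRelativeDimension_hom_of_baseChangeHom`), and projectivity descends along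
the field extension (tree `Motives.IsProjectiveOver.of_baseChange_holds`, Görtz–Wedhorn I 14.57).  Proof steps = B1's, assembled in one theorem.
[cite: EGAIV4, Prop. 17.7.4] [cite: GortzWedhorn2020, Prop. 14.57 (p. 571)] [cite: Deligne1979ShimuraVarieties, 2.2.5] -/
theorem smooth_and_projective_of_form (Sc : ComplexRecordSystem L H τ T hT K₀) (M : C5.SmallLevel K₀ ⥤ SchemeOver L)
    (e : (M ⋙ Motives.baseChangeHom τ) ≅ Sc.Mc) (K : C5.SmallLevel K₀) :
    AlgebraicGeometry.SmoothOfRelativeDimension 2 (M.obj K).hom ∧ IsProjectiveOver (M.obj K) := by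
  letI : Algebra L ℂ := τ.toAlgebra
  -- the component of the form at `K`, an isomorphism of `ℂ`-schemes `(M_K)_τ ≅ Sc.Mc_K`
  let eK : (Motives.baseChangeHom τ).obj (M.obj K) ≅ Sc.Mc.obj K := e.app K
  haveI : IsIso eK.hom.left := (inferInstance : IsIso ((Over.forget _).mapIso eK).hom)
  haveI := Sc.smooth K
  refine ⟨?_, ?_⟩
  · -- `(M_K)_τ → Spec ℂ` = `eK ≫ (Sc.Mc_K → Spec ℂ)` is smooth of relative dimension `2`
    haveI hbc : AlgebraicGeometry.SmoothOfRelativeDimension 2 ((Motives.baseChangeHom τ).obj (M.obj K)).hom := by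
      rw [← Over.w eK.hom]
      exact (MorphismProperty.cancel_left_of_respectsIso (@AlgebraicGeometry.SmoothOfRelativeDimension 2) _ _).mpr (Sc.smooth K)
    haveI : Smooth ((Motives.baseChangeHom τ).obj (M.obj K)).hom := AlgebraicGeometry.SmoothOfRelativeDimension.smooth 2 _
    -- fpqc descent of smoothness along `Spec ℂ → Spec L`
    haveI : Smooth (M.obj K).hom := by
      haveI : Subsingleton ↥(Spec (CommRingCat.of L)) := inferInstanceAs (Subsingleton (PrimeSpectrum L))
      haveI : AlgebraicGeometry.Surjective (Spec.map (CommRingCat.ofHom τ)) :=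
        ⟨fun x ↦ ⟨(default : ↥(Spec (CommRingCat.of ℂ))), Subsingleton.elim _ _⟩⟩
      have hQ : (@AlgebraicGeometry.Surjective ⊓ @Flat ⊓ @QuasiCompact : MorphismProperty Scheme) (Spec.map (CommRingCat.ofHom τ)) :=
        ⟨⟨‹_›, inferInstance⟩, inferInstance⟩
      exact MorphismProperty.of_isPullback_of_descendsAlong (P := @Smooth) (Q := @AlgebraicGeometry.Surjective ⊓ @Flat ⊓ @QuasiCompact)
        (IsPullback.of_hasPullback (M.obj K).hom (Spec.map (CommRingCat.ofHom τ))).flip hQ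
        (show Smooth (pullback.snd (M.obj K).hom (Spec.map (CommRingCat.ofHom τ))) from
          ‹Smooth ((Motives.baseChangeHom τ).obj (M.obj K)).hom›)
    exact Literature.AlgebraicGeometry.HodgeTheory.smoothOfRelativeDimension_hom_of_baseChangeHom τ (M.obj K)
  · -- projectivity over `ℂ` transports along `eK` and descends along `τ : L → ℂ`
    have hbc : IsProjectiveOver ((Motives.baseChangeHom τ).obj (M.obj K)) := by
      obtain ⟨n, κ, hκ⟩ := Sc.projective K
      haveI := hκ
      exact ⟨n, eK.hom ≫ κ, inferInstanceAs (IsClosedImmersion (eK.hom.left ≫ κ.left))⟩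
    exact Motives.IsProjectiveOver.of_baseChange_holds (M.obj K) ℂ hbc

/-- **B1's `canonicalModel_exists_printed_iff_form.mpr`, re-proved locally**: the printed form-only statement ([Deligne1979ShimuraVarieties]
2.2.5 + Cor. 2.7.21: a form of `M_ℂ(G,X)` over `τ(L)` with (62) at the diagonal special pairs — the BODY of ✔ B1's
`UnitaryCanonicalModel.canonicalModel_exists_form`, names fully qualified) implies `UnitaryCanonicalModel.canonicalModel_exists_printed` (row L1):
the two extra clauses `smooth` ∕ `projective` are supplied by descent (§0).  Proof byte-identical to B1's `←` branch.
[cite: Deligne1979ShimuraVarieties, 2.2.5 and Cor. 2.7.21 (PDF pp. 29, 51–52 of Milne's translation)] [cite: GortzWedhorn2020, Prop. 14.57 (p. 571)]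
[cite: EGAIV4, Prop. 17.7.4] -/
theorem canonicalModel_exists_printed_of_form
    (h :
      ∀ (L : Type) [Field L] [NumberField L] [NumberField.IsCMField L] (H : Matrix (Fin 3) (Fin 3) L) (τ : L →+* ℂ)
        (T : GL (Fin 3) ℂ) (hT : Literature.NumberTheory.Automorphic.formCongr (starRingEnd ℂ) T (H.map τ) = Literature.Geometry.ComplexHyperbolic.BallModel.J),
        (∀ τ' : L →+* ℂ, NumberField.InfinitePlace.mk τ' ≠ NumberField.InfinitePlace.mk τ → (H.map τ').PosDef) →
        (∀ v : Fin 3 → L, Literature.AlgebraicGeometry.ShimuraVarieties.hermForm (Literature.NumberTheory.Automorphic.cmConjRingHom L) H v v = 0 → v = 0) →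
        ∀ K₀ : Literature.NumberTheory.Automorphic.Liu2021.AppendixC.C5.OpenCompactSubgroup
            ↥(Literature.NumberTheory.Automorphic.UnitaryGroup.finAdelic (↥(NumberField.maximalRealSubfield L)) L (NumberField.IsCMField.complexConj L) 3 H),
          (∀ g : Literature.NumberTheory.Automorphic.UnitaryGroup.finAdelic (↥(NumberField.maximalRealSubfield L)) L (NumberField.IsCMField.complexConj L) 3 H,
            ∀ γ ∈ Literature.NumberTheory.Automorphic.UnitaryGroup.arithmeticLevel (↥(NumberField.maximalRealSubfield L)) L (NumberField.IsCMField.complexConj L) 3 H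
              (K₀.1.map (MulAut.conj g).toMonoidHom), IsOfFinOrder γ → γ = 1) →
            ∀ Sc : Literature.AlgebraicGeometry.ShimuraVarieties.UnitaryCanonicalModel.ComplexRecordSystem L H τ T hT K₀,
              ∃ (M : CategoryTheory.Functor (Literature.NumberTheory.Automorphic.Liu2021.AppendixC.C5.SmallLevel K₀) (Literature.AlgebraicGeometry.Motives.SchemeOver L))
                (e : CategoryTheory.Iso (M.comp (Literature.AlgebraicGeometry.Motives.baseChangeHom τ)) Sc.Mc),
                Literature.AlgebraicGeometry.ShimuraVarieties.UnitaryCanonicalModel.IsCanonicalDescentAt Sc M e) :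
    Literature.AlgebraicGeometry.ShimuraVarieties.UnitaryCanonicalModel.canonicalModel_exists_printed := by
  intro L _ _ _ H τ T hT hpos hanis K₀ htf Sc
  obtain ⟨M, e, hrec⟩ := h L H τ T hT hpos hanis K₀ htf Sc
  exact ⟨M, fun K => (smooth_and_projective_of_form Sc M e K).1, fun K => (smooth_and_projective_of_form Sc M e K).2, e, hrec⟩

/-- **The displayed formula IS row L1's `canonicalModel_exists_printed` up to the two descended clauses** (kernel `↔`, this file): `→` is
`canonicalModel_exists_printed_of_form` (descent, §0), `←` forgets `smooth` ∕ `projective`.  With ✔ B1's `canonicalModel_exists_printed_iff_form`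
(whose right-hand side is this formula by `Iff.rfl` once B1's olean exists) and ✔ S1a ∕ ✔ S1b′ (`exists_recordSystem ↔ canonicalModel_exists_printed`)
the displayed binder 1 is kernel-equivalent to the packaged record `exists_recordSystem` of the source END.
[cite: Deligne1979ShimuraVarieties, 2.2.5 and Cor. 2.7.21 (PDF pp. 29, 51–52 of Milne's translation)] -/
theorem form_iff_canonicalModel_exists_printed :
    (
      ∀ (L : Type) [Field L] [NumberField L] [NumberField.IsCMField L] (H : Matrix (Fin 3) (Fin 3) L) (τ : L →+* ℂ)
        (T : GL (Fin 3) ℂ) (hT : Literature.NumberTheory.Automorphic.formCongr (starRingEnd ℂ) T (H.map τ) = Literature.Geometry.ComplexHyperbolic.BallModel.J),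
        (∀ τ' : L →+* ℂ, NumberField.InfinitePlace.mk τ' ≠ NumberField.InfinitePlace.mk τ → (H.map τ').PosDef) →
        (∀ v : Fin 3 → L, Literature.AlgebraicGeometry.ShimuraVarieties.hermForm (Literature.NumberTheory.Automorphic.cmConjRingHom L) H v v = 0 → v = 0) →
        ∀ K₀ : Literature.NumberTheory.Automorphic.Liu2021.AppendixC.C5.OpenCompactSubgroup
            ↥(Literature.NumberTheory.Automorphic.UnitaryGroup.finAdelic (↥(NumberField.maximalRealSubfield L)) L (NumberField.IsCMField.complexConj L) 3 H),
          (∀ g : Literature.NumberTheory.Automorphic.UnitaryGroup.finAdelic (↥(NumberField.maximalRealSubfield L)) L (NumberField.IsCMField.complexConj L) 3 H,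
            ∀ γ ∈ Literature.NumberTheory.Automorphic.UnitaryGroup.arithmeticLevel (↥(NumberField.maximalRealSubfield L)) L (NumberField.IsCMField.complexConj L) 3 H
              (K₀.1.map (MulAut.conj g).toMonoidHom), IsOfFinOrder γ → γ = 1) →
            ∀ Sc : Literature.AlgebraicGeometry.ShimuraVarieties.UnitaryCanonicalModel.ComplexRecordSystem L H τ T hT K₀,
              ∃ (M : CategoryTheory.Functor (Literature.NumberTheory.Automorphic.Liu2021.AppendixC.C5.SmallLevel K₀) (Literature.AlgebraicGeometry.Motives.SchemeOver L))
                (e : CategoryTheory.Iso (M.comp (Literature.AlgebraicGeometry.Motives.baseChangeHom τ)) Sc.Mc),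
                Literature.AlgebraicGeometry.ShimuraVarieties.UnitaryCanonicalModel.IsCanonicalDescentAt Sc M e) ↔
    Literature.AlgebraicGeometry.ShimuraVarieties.UnitaryCanonicalModel.canonicalModel_exists_printed := by
  constructor
  · exact canonicalModel_exists_printed_of_form
  · intro h L _ _ _ H τ T hT hpos hanis K₀ htf Sc
    obtain ⟨M, -, -, e, hrec⟩ := h L H τ T hT hpos hanis K₀ htf Sc
    exact ⟨M, e, hrec⟩

end LocalDescent

open scoped TensorProduct Matrix
open scoped ComplexOrder  -- `Matrix.PosDef` over `ℂ` in the displayed formula of binder 1 (as in rows L1 ∕ B1)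
open NumberField NumberField.InfinitePlace
open HodgeCM.Model HodgeCM.Model.LiuIndex HodgeCM.Model.TowerCarrier
open HodgeCM.Literature.Theta.LiuAlbaneseModuleDatum.D2Bridge (HcmPieces)
open Summit.HodgeConjecture.CorCM.Model
open Literature.AlgebraicGeometry.Motives (CMType)
open Literature.AlgebraicGeometry.HodgeTheory Literature.NumberTheory.Automorphic.PicardCM
open Literature.AlgebraicGeometry.ShimuraVarieties.UnitaryCanonicalModel
open Literature.NumberTheory.ComplexMultiplication
open Literature.NumberTheory.Automorphic
open Literature.NumberTheory.Automorphic.IdeleClassGroup (toHeckeCharacter isUnitary_toHeckeCharacter)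
open Literature.NumberTheory.Automorphic.Liu2021 Literature.NumberTheory.Automorphic.Liu2021.AppendixC
open Literature.NumberTheory.Automorphic.Liu2021.AppendixC.RestOne
open Literature.NumberTheory.Automorphic.Liu2021.Def411WeilCarriers (lineOf locF Rep)
open Summit.HodgeConjecture.CorCM.Transposition.OmegaTransport (realUnit)
open HodgeCM.Model.ArchSideTerm (e₁)
open Literature.NumberTheory.GelbartRogawski1991 Literature.NumberTheory.GelbartRogawski1991.UnitaryDualPair
open Literature.NumberTheory.GelbartRogawski1991.UnitaryDualPair.LocalSplitting (localMu norm_localMu continuous_localMu localMu_toLocalRing_eq_one_iff)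
open Literature.RepresentationTheory Literature.RepresentationTheory.Liu2021
open Summit.HodgeConjecture.CorCM.Transposition
open Summit.HodgeConjecture.CorCM.D2Bridge.AdapterMuConj (muConj prop413AsPrinted_muConj def411_muConj nontrivial_omegaAt_muConj_rest)
open Summit.HodgeConjecture.CorCM.D2Bridge.AdapterRelabel (isReflexOfTypeG_cmType_iff_starRingEnd_comp_galConj)
open Summit.HodgeConjecture.CorCM.D2Bridge.MuConjEnd (thm418C_indexOfRecord_of_muConj)
open Summit.HodgeConjecture.CorCM.D2Bridge.MuKeyEnd

/-! ## §1. The END `hc_cm_of_printed_citations_muKey` with the Deligne record split: `h := exists_recordSystem_of_printed (canonicalModel_exists_printed_of_form hDel')` -/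

set_option synthInstance.maxHeartbeats 400000 in
set_option maxHeartbeats 6400000 in
/-- **DelRec variant of `Summit.HodgeConjecture.CorCM.D2Bridge.MuKeyEnd.hc_cm_of_printed_citations_muKey` — `HC_CM` FROM THE PRINTED CITATIONS with the Deligne record displayed AS PRINTED.**
Displayed: `hDel'` = [Deligne 1979, 2.2.5 + Cor. 2.7.21; 2.1.2–2.1.4] AS PRINTED at the datum `(Res_{L⁺/ℚ} U(H), 𝔹²)` of [Liu 2021, App. C] — every complex record system below a neat level (the complex Shimura surface `M_ℂ(G,X)`, unique up to `pts`-isomorphism) admits a FORM over the reflex field `E(G,X) = τ(L)` (models `M_K` functorial in the level with `e : M ⊗_{{L,τ}} ℂ ≅ Sc.Mc`) on which `Aut(ℂ/τL)` acts at the diagonal special points by 2.2.4 = the reciprocity law (62) of [Milne 2005, Def. 12.8] — and NOTHING ELSE (the BODY of `UnitaryCanonicalModel.canonicalModel_exists_form`, row B1, displayed as a formula because B1's hub olean is absent; smoothness ∕ projectivity of the models are NOT displayed: they descend along `τ`, kernel theorems of row B1, composed here as `DelRec.exists_recordSystem_of_printed (canonicalModel_exists_printed_of_form hDel')`, §0);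 then `h21 ∕ hLiuC ∕ h411 ∕ h413 ∕ hμsep ∕ hD1''` VERBATIM from the source END up to the substitution
`h ↦ (exists_recordSystem_of_printed (canonicalModel_exists_printed_of_form hDel'))` (their print-instance readings are the source END's, unchanged).  KERNEL: ONE application of
`Summit.HodgeConjecture.CorCM.D2Bridge.MuKeyEnd.hc_cm_of_printed_citations_muKey`.  HC_CM is NOT proved unconditionally: the displayed citations are hypotheses; whether this is an edition ∕ candidate of
record is the COORDINATOR's ∕ referees' call.
[cite: Deligne1979ShimuraVarieties, §2.1.2–2.1.4, 2.2.4–2.2.5 and Cor. 2.7.21 (PDF pp. 24, 29, 52 of Milne's translation)]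
[cite: Milne2005ShimuraVarieties, Def. 12.8 (62) p. 114; Def. 12.10 p. 115] [cite: Liu2021, App. C §C.1 and Rem. C.2] -/
theorem hc_cm_of_printed_citations_muKey_delRecFormLocal
    -- [Deligne 1979, 2.2.5 + Cor. 2.7.21] AS PRINTED («M_ℂ(G,X) admits a form over E(G,X) = τ(L) with (62) at the [diagonal] special points»):
    -- the BODY of ✔ B1 `UnitaryCanonicalModel.canonicalModel_exists_form` (tree 7891b98d2741f1b2 :123–:132), names fully qualified, `⥤ ∕ ⋙ ∕ ≅` spelled out
    (hDel' :
      ∀ (L : Type) [Field L] [NumberField L] [NumberField.IsCMField L] (H : Matrix (Fin 3) (Fin 3) L) (τ : L →+* ℂ)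
        (T : GL (Fin 3) ℂ) (hT : Literature.NumberTheory.Automorphic.formCongr (starRingEnd ℂ) T (H.map τ) = Literature.Geometry.ComplexHyperbolic.BallModel.J),
        (∀ τ' : L →+* ℂ, NumberField.InfinitePlace.mk τ' ≠ NumberField.InfinitePlace.mk τ → (H.map τ').PosDef) →
        (∀ v : Fin 3 → L, Literature.AlgebraicGeometry.ShimuraVarieties.hermForm (Literature.NumberTheory.Automorphic.cmConjRingHom L) H v v = 0 → v = 0) →
        ∀ K₀ : Literature.NumberTheory.Automorphic.Liu2021.AppendixC.C5.OpenCompactSubgroup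
            ↥(Literature.NumberTheory.Automorphic.UnitaryGroup.finAdelic (↥(NumberField.maximalRealSubfield L)) L (NumberField.IsCMField.complexConj L) 3 H),
          (∀ g : Literature.NumberTheory.Automorphic.UnitaryGroup.finAdelic (↥(NumberField.maximalRealSubfield L)) L (NumberField.IsCMField.complexConj L) 3 H,
            ∀ γ ∈ Literature.NumberTheory.Automorphic.UnitaryGroup.arithmeticLevel (↥(NumberField.maximalRealSubfield L)) L (NumberField.IsCMField.complexConj L) 3 H
              (K₀.1.map (MulAut.conj g).toMonoidHom), IsOfFinOrder γ → γ = 1) →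
            ∀ Sc : Literature.AlgebraicGeometry.ShimuraVarieties.UnitaryCanonicalModel.ComplexRecordSystem L H τ T hT K₀,
              ∃ (M : CategoryTheory.Functor (Literature.NumberTheory.Automorphic.Liu2021.AppendixC.C5.SmallLevel K₀) (Literature.AlgebraicGeometry.Motives.SchemeOver L))
                (e : CategoryTheory.Iso (M.comp (Literature.AlgebraicGeometry.Motives.baseChangeHom τ)) Sc.Mc),
                Literature.AlgebraicGeometry.ShimuraVarieties.UnitaryCanonicalModel.IsCanonicalDescentAt Sc M e)
    (h21 : shimura1998_thm21_4_casselman)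
    -- [Liu21, Thm 4.18] AS PRINTED at the RELABELLED rests of 𝕌(a) (tail at `ν`, blocks `ω(νᶜ, ·, ·)`): Thm 4.18 for (X(𝕍^{(c)}), ν) under WORLD C — scalar-keyed
    (hLiuC : ∀ (F : HodgeCM.CMField) [IsGalois ℚ F] (h6 : 6 ≤ Module.finrank ℚ F) {ι₁ : F →+* ℂ} (V : HodgeCM.HermSpace3 F ι₁) (a : RealScalar F)
      (Φ : CMType F) (hΦ : ι₁ ∈ Φ.1) (ν : Literature.NumberTheory.Automorphic.IdeleClassGroup (F : Type) →ₜ* Circle)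
      (hν : IdeleClassGroup.IsConjugateSymplectic (F : Type) ν) (hw : IdeleClassGroup.HasWeight (F : Type) ν 1),
      Thm418AsPrinted (toThm418Data _ ((Summit.HodgeConjecture.CorCM.D2Bridge.AdapterMuConj.muConj (uniformOmegaRep (Summit.HodgeConjecture.CorCM.DelRec.exists_recordSystem_of_printed (Summit.HodgeConjecture.CorCM.D2Bridge.MuKeyEndDelRecFormLocal.canonicalModel_exists_printed_of_form hDel')) ⟨HodgeCM.CMField.K F⟩ ι₁ ⟨HodgeCM.HermSpace3.Hm V, HodgeCM.HermSpace3.isHermitian V, HodgeCM.HermSpace3.signature_ι₁ V, HodgeCM.HermSpace3.posDef_of_ne V⟩ Φ e₁ (frameD V) (frameD_real V) (frameD_ne V) (ιVE V) (2 * imagUnit (HodgeCM.CMField.K F))⁻¹ (fun _ _ => (Rep.update ↥(maximalRealSubfield (HodgeCM.CMField.K F)) (imagUnitSq (HodgeCM.CMField.K F)) (Rep.ofLineOf ↥(maximalRealSubfield (HodgeCM.CMField.K F)) (imagUnitSq (HodgeCM.CMField.K F))) (locF ↥(maximalRealSubfield (HodgeCM.CMField.K F)) (imagUnitSq (HodgeCM.CMField.K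 F)) (realUnit ⟨HodgeCM.CMField.K F⟩ a.1 a.2.1 a.2.2)) (realUnit ⟨HodgeCM.CMField.K F⟩ a.1 a.2.1 a.2.2) rfl)))).rest (restTailOne (AlgHom.id ℚ _) ι₁ hν hw (Def45.Carriers.ofPolDR ν (Def45.PolDR ι₁ hν (Def45.RMuForm ι₁ hν))) ((heckeTranslatesFamilyOf heckeTranslate_definedOver_holds (Summit.HodgeConjecture.CorCM.DelRec.exists_recordSystem_of_printed (Summit.HodgeConjecture.CorCM.D2Bridge.MuKeyEndDelRecFormLocal.canonicalModel_exists_printed_of_form hDel')) isoOf ⟨HodgeCM.CMField.K F⟩ ι₁ ⟨HodgeCM.HermSpace3.Hm V, HodgeCM.HermSpace3.isHermitian V, HodgeCM.HermSpace3.signature_ι₁ V, HodgeCM.HermSpace3.posDef_of_ne V⟩ Φ h6).rhoΩOne (AlgHom.id ℚ _) ι₁ hν hw (Def45.Carriers.ofPolDR ν (Def45.PolDR ι₁ hν (Def45.RMuForm ι₁ hν))))))))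
    -- [Liu21, Def 4.11] AS PRINTED at the rests of record 𝔯δ′⟦a, μ⟧ — scalar-keyed
    (h411 : ∀ (F : HodgeCM.CMField) [IsGalois ℚ F] (h6 : 6 ≤ Module.finrank ℚ F) {ι₁ : F →+* ℂ} (V : HodgeCM.HermSpace3 F ι₁) (a : RealScalar F)
      (Φ : CMType F) (hΦ : ι₁ ∈ Φ.1) (μ : Literature.NumberTheory.Automorphic.IdeleClassGroup (F : Type) →ₜ* Circle)
      (hμ : IdeleClassGroup.IsConjugateSymplectic (F : Type) μ) (hw : IdeleClassGroup.HasWeight (F : Type) μ 1),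
      Def411AsPrinted (toThm418Data _ (restOfCharDeltaPrime (Summit.HodgeConjecture.CorCM.DelRec.exists_recordSystem_of_printed (Summit.HodgeConjecture.CorCM.D2Bridge.MuKeyEndDelRecFormLocal.canonicalModel_exists_printed_of_form hDel')) ⟨HodgeCM.CMField.K F⟩ h6 ι₁ ⟨HodgeCM.HermSpace3.Hm V, HodgeCM.HermSpace3.isHermitian V, HodgeCM.HermSpace3.signature_ι₁ V, HodgeCM.HermSpace3.posDef_of_ne V⟩ Φ e₁ (frameD V) (frameD_real V) (frameD_ne V) (ιVE V) (Rep.update ↥(maximalRealSubfield (HodgeCM.CMField.K F)) (imagUnitSq (HodgeCM.CMField.K F)) (Rep.ofLineOf ↥(maximalRealSubfield (HodgeCM.CMField.K F)) (imagUnitSq (HodgeCM.CMField.K F))) (locF ↥(maximalRealSubfield (HodgeCM.CMField.K F)) (imagUnitSq (HodgeCM.CMField.K F)) (realUnit ⟨HodgeCM.CMField.K F⟩ a.1 a.2.1 a.2.2)) (realUnit ⟨HodgeCM.CMField.K F⟩ a.1 a.2.1 a.2.2) rfl) μ hμ hw)))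
    -- [Liu21, Prop 4.13] AS PRINTED at the tower over the uniform carriers of each index line (Δ2 side only)
    (h413 : ∀ (F : HodgeCM.CMField) [IsGalois ℚ F] (h6 : 6 ≤ Module.finrank ℚ F) {ι₁ : F →+* ℂ} (V : HodgeCM.HermSpace3 F ι₁) (a₀ : RealScalar F)
      (Φ : CMType F) (hΦ : ι₁ ∈ Φ.1) (i : (I V (repAt a₀) (muLiu ι₁ GramClass.rep))), Prop413AsPrinted (((uniformOmegaRep (Summit.HodgeConjecture.CorCM.DelRec.exists_recordSystem_of_printed (Summit.HodgeConjecture.CorCM.D2Bridge.MuKeyEndDelRecFormLocal.canonicalModel_exists_printed_of_form hDel')) ⟨HodgeCM.CMField.K F⟩ ι₁ ⟨HodgeCM.HermSpace3.Hm V, HodgeCM.HermSpace3.isHermitian V, HodgeCM.HermSpace3.signature_ι₁ V, HodgeCM.HermSpace3.posDef_of_ne V⟩ Φ e₁ (frameD V) (frameD_real V) (frameD_ne V) (ιVE V) (2 * imagUnit (HodgeCM.CMField.K F))⁻¹ (fun _ _ => (Rep.update ↥(maximalRealSubfield (HodgeCM.CMField.K F)) (imagUnitSq (HodgeCM.CMField.K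 F)) (Rep.ofLineOf ↥(maximalRealSubfield (HodgeCM.CMField.K F)) (imagUnitSq (HodgeCM.CMField.K F))) (locF ↥(maximalRealSubfield (HodgeCM.CMField.K F)) (imagUnitSq (HodgeCM.CMField.K F)) (realUnit ⟨HodgeCM.CMField.K F⟩ (repAt a₀ (Sigma.fst i)).1 (repAt a₀ (Sigma.fst i)).2.1 (repAt a₀ (Sigma.fst i)).2.2)) (realUnit ⟨HodgeCM.CMField.K F⟩ (repAt a₀ (Sigma.fst i)).1 (repAt a₀ (Sigma.fst i)).2.1 (repAt a₀ (Sigma.fst i)).2.2) rfl)))).prop413Data ((liuDictionaryPin exists_isReal_hodgeModel_holds hodgePQ_independent_of_hodgeModel_holds BallQuotient.ballQuotientUniformised_holds (cmAbelianVarietyRealised_of_eigenbasis exists_isReal_hodgeModel_holds hodgePQ_independent_of_hodgeModel_holds cmAbelianVarietyEigenbasisRealised_holds) Literature.NumberTheory.Transcendental.arapura2012_cor_15_4_6_holds V (I V (repAt a₀) (muLiu ι₁ GramClass.rep)) (line V (repAt a₀) (muLiu ι₁ GramClass.rep)))).H))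
    -- the cross-μ leg of [Liu21, App. D Lem D.1 (3)] («μ = ⊗_v μ_v») per index line (Δ2 side only)
    (hμsep : ∀ (F : HodgeCM.CMField) [IsGalois ℚ F] (h6 : 6 ≤ Module.finrank ℚ F) {ι₁ : F →+* ℂ} (V : HodgeCM.HermSpace3 F ι₁) (a₀ : RealScalar F)
      (Φ : CMType F) (hΦ : ι₁ ∈ Φ.1) (i : (I V (repAt a₀) (muLiu ι₁ GramClass.rep))) (s t : (((uniformOmegaRep (Summit.HodgeConjecture.CorCM.DelRec.exists_recordSystem_of_printed (Summit.HodgeConjecture.CorCM.D2Bridge.MuKeyEndDelRecFormLocal.canonicalModel_exists_printed_of_form hDel')) ⟨HodgeCM.CMField.K F⟩ ι₁ ⟨HodgeCM.HermSpace3.Hm V, HodgeCM.HermSpace3.isHermitian V, HodgeCM.HermSpace3.signature_ι₁ V, HodgeCM.HermSpace3.posDef_of_ne V⟩ Φ e₁ (frameD V) (frameD_real V) (frameD_ne V) (ιVE V) (2 * imagUnit (HodgeCM.CMField.K F))⁻¹ (fun _ _ => (Rep.update ↥(maximalRealSubfield (HodgeCM.CMField.K F)) (imagUnitSq (HodgeCM.CMField.K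 F)) (Rep.ofLineOf ↥(maximalRealSubfield (HodgeCM.CMField.K F)) (imagUnitSq (HodgeCM.CMField.K F))) (locF ↥(maximalRealSubfield (HodgeCM.CMField.K F)) (imagUnitSq (HodgeCM.CMField.K F)) (realUnit ⟨HodgeCM.CMField.K F⟩ (repAt a₀ (Sigma.fst i)).1 (repAt a₀ (Sigma.fst i)).2.1 (repAt a₀ (Sigma.fst i)).2.2)) (realUnit ⟨HodgeCM.CMField.K F⟩ (repAt a₀ (Sigma.fst i)).1 (repAt a₀ (Sigma.fst i)).2.1 (repAt a₀ (Sigma.fst i)).2.2) rfl)))).prop413Data ((liuDictionaryPin exists_isReal_hodgeModel_holds hodgePQ_independent_of_hodgeModel_holds BallQuotient.ballQuotientUniformised_holds (cmAbelianVarietyRealised_of_eigenbasis exists_isReal_hodgeModel_holds hodgePQ_independent_of_hodgeModel_holds cmAbelianVarietyEigenbasisRealised_holds) Literature.NumberTheory.Transcendental.arapura2012_cor_15_4_6_holds V (I V (repAt a₀) (muLiu ι₁ GramClass.rep)) (line V (repAt a₀) (muLiu ι₁ GramClass.rep)))).H).AdmTriple), Nontrivial ((((uniformOmegaRep (Summit.HodgeConjecture.CorCM.DelRec.exists_recordSystem_of_printed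 (Summit.HodgeConjecture.CorCM.D2Bridge.MuKeyEndDelRecFormLocal.canonicalModel_exists_printed_of_form hDel')) ⟨HodgeCM.CMField.K F⟩ ι₁ ⟨HodgeCM.HermSpace3.Hm V, HodgeCM.HermSpace3.isHermitian V, HodgeCM.HermSpace3.signature_ι₁ V, HodgeCM.HermSpace3.posDef_of_ne V⟩ Φ e₁ (frameD V) (frameD_real V) (frameD_ne V) (ιVE V) (2 * imagUnit (HodgeCM.CMField.K F))⁻¹ (fun _ _ => (Rep.update ↥(maximalRealSubfield (HodgeCM.CMField.K F)) (imagUnitSq (HodgeCM.CMField.K F)) (Rep.ofLineOf ↥(maximalRealSubfield (HodgeCM.CMField.K F)) (imagUnitSq (HodgeCM.CMField.K F))) (locF ↥(maximalRealSubfield (HodgeCM.CMField.K F)) (imagUnitSq (HodgeCM.CMField.K F)) (realUnit ⟨HodgeCM.CMField.K F⟩ (repAt a₀ (Sigma.fst i)).1 (repAt a₀ (Sigma.fst i)).2.1 (repAt a₀ (Sigma.fst i)).2.2)) (realUnit ⟨HodgeCM.CMField.K F⟩ (repAt a₀ (Sigma.fst i)).1 (repAt a₀ (Sigma.fst i)).2.1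 (repAt a₀ (Sigma.fst i)).2.2) rfl)))).prop413Data ((liuDictionaryPin exists_isReal_hodgeModel_holds hodgePQ_independent_of_hodgeModel_holds BallQuotient.ballQuotientUniformised_holds (cmAbelianVarietyRealised_of_eigenbasis exists_isReal_hodgeModel_holds hodgePQ_independent_of_hodgeModel_holds cmAbelianVarietyEigenbasisRealised_holds) Literature.NumberTheory.Transcendental.arapura2012_cor_15_4_6_holds V (I V (repAt a₀) (muLiu ι₁ GramClass.rep)) (line V (repAt a₀) (muLiu ι₁ GramClass.rep)))).H).omegaAt s) →
      (∃ f : (((uniformOmegaRep (Summit.HodgeConjecture.CorCM.DelRec.exists_recordSystem_of_printed (Summit.HodgeConjecture.CorCM.D2Bridge.MuKeyEndDelRecFormLocal.canonicalModel_exists_printed_of_form hDel')) ⟨HodgeCM.CMField.K F⟩ ι₁ ⟨HodgeCM.HermSpace3.Hm V, HodgeCM.HermSpace3.isHermitian V, HodgeCM.HermSpace3.signature_ι₁ V, HodgeCM.HermSpace3.posDef_of_ne V⟩ Φ e₁ (frameD V) (frameD_real V) (frameD_ne V) (ιVE V) (2 * imagUnit (HodgeCM.CMField.K F))⁻¹ (fun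 _ _ => (Rep.update ↥(maximalRealSubfield (HodgeCM.CMField.K F)) (imagUnitSq (HodgeCM.CMField.K F)) (Rep.ofLineOf ↥(maximalRealSubfield (HodgeCM.CMField.K F)) (imagUnitSq (HodgeCM.CMField.K F))) (locF ↥(maximalRealSubfield (HodgeCM.CMField.K F)) (imagUnitSq (HodgeCM.CMField.K F)) (realUnit ⟨HodgeCM.CMField.K F⟩ (repAt a₀ (Sigma.fst i)).1 (repAt a₀ (Sigma.fst i)).2.1 (repAt a₀ (Sigma.fst i)).2.2)) (realUnit ⟨HodgeCM.CMField.K F⟩ (repAt a₀ (Sigma.fst i)).1 (repAt a₀ (Sigma.fst i)).2.1 (repAt a₀ (Sigma.fst i)).2.2) rfl)))).prop413Data ((liuDictionaryPin exists_isReal_hodgeModel_holds hodgePQ_independent_of_hodgeModel_holds BallQuotient.ballQuotientUniformised_holds (cmAbelianVarietyRealised_of_eigenbasis exists_isReal_hodgeModel_holds hodgePQ_independent_of_hodgeModel_holds cmAbelianVarietyEigenbasisRealised_holds) Literature.NumberTheory.Transcendental.arapura2012_cor_15_4_6_holds V (I V (repAt a₀) (muLiu ι₁ GramClass.rep)) (line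 V (repAt a₀) (muLiu ι₁ GramClass.rep)))).H).omegaAt s ≃ₗ[ℂ] (((uniformOmegaRep (Summit.HodgeConjecture.CorCM.DelRec.exists_recordSystem_of_printed (Summit.HodgeConjecture.CorCM.D2Bridge.MuKeyEndDelRecFormLocal.canonicalModel_exists_printed_of_form hDel')) ⟨HodgeCM.CMField.K F⟩ ι₁ ⟨HodgeCM.HermSpace3.Hm V, HodgeCM.HermSpace3.isHermitian V, HodgeCM.HermSpace3.signature_ι₁ V, HodgeCM.HermSpace3.posDef_of_ne V⟩ Φ e₁ (frameD V) (frameD_real V) (frameD_ne V) (ιVE V) (2 * imagUnit (HodgeCM.CMField.K F))⁻¹ (fun _ _ => (Rep.update ↥(maximalRealSubfield (HodgeCM.CMField.K F)) (imagUnitSq (HodgeCM.CMField.K F)) (Rep.ofLineOf ↥(maximalRealSubfield (HodgeCM.CMField.K F)) (imagUnitSq (HodgeCM.CMField.K F))) (locF ↥(maximalRealSubfield (HodgeCM.CMField.K F)) (imagUnitSq (HodgeCM.CMField.K F)) (realUnit ⟨HodgeCM.CMField.K F⟩ (repAt a₀ (Sigma.fst i)).1 (repAt a₀ (Sigma.fst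 i)).2.1 (repAt a₀ (Sigma.fst i)).2.2)) (realUnit ⟨HodgeCM.CMField.K F⟩ (repAt a₀ (Sigma.fst i)).1 (repAt a₀ (Sigma.fst i)).2.1 (repAt a₀ (Sigma.fst i)).2.2) rfl)))).prop413Data ((liuDictionaryPin exists_isReal_hodgeModel_holds hodgePQ_independent_of_hodgeModel_holds BallQuotient.ballQuotientUniformised_holds (cmAbelianVarietyRealised_of_eigenbasis exists_isReal_hodgeModel_holds hodgePQ_independent_of_hodgeModel_holds cmAbelianVarietyEigenbasisRealised_holds) Literature.NumberTheory.Transcendental.arapura2012_cor_15_4_6_holds V (I V (repAt a₀) (muLiu ι₁ GramClass.rep)) (line V (repAt a₀) (muLiu ι₁ GramClass.rep)))).H).omegaAt t,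
        ∀ (g : ↥V.adelicFin) (v : (((uniformOmegaRep (Summit.HodgeConjecture.CorCM.DelRec.exists_recordSystem_of_printed (Summit.HodgeConjecture.CorCM.D2Bridge.MuKeyEndDelRecFormLocal.canonicalModel_exists_printed_of_form hDel')) ⟨HodgeCM.CMField.K F⟩ ι₁ ⟨HodgeCM.HermSpace3.Hm V, HodgeCM.HermSpace3.isHermitian V, HodgeCM.HermSpace3.signature_ι₁ V, HodgeCM.HermSpace3.posDef_of_ne V⟩ Φ e₁ (frameD V) (frameD_real V) (frameD_ne V) (ιVE V) (2 * imagUnit (HodgeCM.CMField.K F))⁻¹ (fun _ _ => (Rep.update ↥(maximalRealSubfield (HodgeCM.CMField.K F)) (imagUnitSq (HodgeCM.CMField.K F)) (Rep.ofLineOf ↥(maximalRealSubfield (HodgeCM.CMField.K F)) (imagUnitSq (HodgeCM.CMField.K F))) (locF ↥(maximalRealSubfield (HodgeCM.CMField.K F)) (imagUnitSq (HodgeCM.CMField.K F)) (realUnit ⟨HodgeCM.CMField.K F⟩ (repAt a₀ (Sigma.fst i)).1 (repAt a₀ (Sigma.fst i)).2.1 (repAt a₀ (Sigma.fst i)).2.2))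 (realUnit ⟨HodgeCM.CMField.K F⟩ (repAt a₀ (Sigma.fst i)).1 (repAt a₀ (Sigma.fst i)).2.1 (repAt a₀ (Sigma.fst i)).2.2) rfl)))).prop413Data ((liuDictionaryPin exists_isReal_hodgeModel_holds hodgePQ_independent_of_hodgeModel_holds BallQuotient.ballQuotientUniformised_holds (cmAbelianVarietyRealised_of_eigenbasis exists_isReal_hodgeModel_holds hodgePQ_independent_of_hodgeModel_holds cmAbelianVarietyEigenbasisRealised_holds) Literature.NumberTheory.Transcendental.arapura2012_cor_15_4_6_holds V (I V (repAt a₀) (muLiu ι₁ GramClass.rep)) (line V (repAt a₀) (muLiu ι₁ GramClass.rep)))).H).omegaAt s), f ((((uniformOmegaRep (Summit.HodgeConjecture.CorCM.DelRec.exists_recordSystem_of_printed (Summit.HodgeConjecture.CorCM.D2Bridge.MuKeyEndDelRecFormLocal.canonicalModel_exists_printed_of_form hDel')) ⟨HodgeCM.CMField.K F⟩ ι₁ ⟨HodgeCM.HermSpace3.Hm V, HodgeCM.HermSpace3.isHermitian V, HodgeCM.HermSpace3.signature_ι₁ V, HodgeCM.HermSpace3.posDef_of_ne V⟩ Φ e₁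 (frameD V) (frameD_real V) (frameD_ne V) (ιVE V) (2 * imagUnit (HodgeCM.CMField.K F))⁻¹ (fun _ _ => (Rep.update ↥(maximalRealSubfield (HodgeCM.CMField.K F)) (imagUnitSq (HodgeCM.CMField.K F)) (Rep.ofLineOf ↥(maximalRealSubfield (HodgeCM.CMField.K F)) (imagUnitSq (HodgeCM.CMField.K F))) (locF ↥(maximalRealSubfield (HodgeCM.CMField.K F)) (imagUnitSq (HodgeCM.CMField.K F)) (realUnit ⟨HodgeCM.CMField.K F⟩ (repAt a₀ (Sigma.fst i)).1 (repAt a₀ (Sigma.fst i)).2.1 (repAt a₀ (Sigma.fst i)).2.2)) (realUnit ⟨HodgeCM.CMField.K F⟩ (repAt a₀ (Sigma.fst i)).1 (repAt a₀ (Sigma.fst i)).2.1 (repAt a₀ (Sigma.fst i)).2.2) rfl)))).prop413Data ((liuDictionaryPin exists_isReal_hodgeModel_holds hodgePQ_independent_of_hodgeModel_holds BallQuotient.ballQuotientUniformised_holds (cmAbelianVarietyRealised_of_eigenbasis exists_isReal_hodgeModel_holds hodgePQ_independent_of_hodgeModel_holds cmAbelianVarietyEigenbasisRealised_holds) Literature.NumberTheory.Transcendental.arapura2012_cor_15_4_6_holds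 V (I V (repAt a₀) (muLiu ι₁ GramClass.rep)) (line V (repAt a₀) (muLiu ι₁ GramClass.rep)))).H).rhoAt s g v) = (((uniformOmegaRep (Summit.HodgeConjecture.CorCM.DelRec.exists_recordSystem_of_printed (Summit.HodgeConjecture.CorCM.D2Bridge.MuKeyEndDelRecFormLocal.canonicalModel_exists_printed_of_form hDel')) ⟨HodgeCM.CMField.K F⟩ ι₁ ⟨HodgeCM.HermSpace3.Hm V, HodgeCM.HermSpace3.isHermitian V, HodgeCM.HermSpace3.signature_ι₁ V, HodgeCM.HermSpace3.posDef_of_ne V⟩ Φ e₁ (frameD V) (frameD_real V) (frameD_ne V) (ιVE V) (2 * imagUnit (HodgeCM.CMField.K F))⁻¹ (fun _ _ => (Rep.update ↥(maximalRealSubfield (HodgeCM.CMField.K F)) (imagUnitSq (HodgeCM.CMField.K F)) (Rep.ofLineOf ↥(maximalRealSubfield (HodgeCM.CMField.K F)) (imagUnitSq (HodgeCM.CMField.K F))) (locF ↥(maximalRealSubfield (HodgeCM.CMField.K F)) (imagUnitSq (HodgeCM.CMField.K F)) (realUnit ⟨HodgeCM.CMField.K F⟩ (repAt a₀ (Sigma.fst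 i)).1 (repAt a₀ (Sigma.fst i)).2.1 (repAt a₀ (Sigma.fst i)).2.2)) (realUnit ⟨HodgeCM.CMField.K F⟩ (repAt a₀ (Sigma.fst i)).1 (repAt a₀ (Sigma.fst i)).2.1 (repAt a₀ (Sigma.fst i)).2.2) rfl)))).prop413Data ((liuDictionaryPin exists_isReal_hodgeModel_holds hodgePQ_independent_of_hodgeModel_holds BallQuotient.ballQuotientUniformised_holds (cmAbelianVarietyRealised_of_eigenbasis exists_isReal_hodgeModel_holds hodgePQ_independent_of_hodgeModel_holds cmAbelianVarietyEigenbasisRealised_holds) Literature.NumberTheory.Transcendental.arapura2012_cor_15_4_6_holds V (I V (repAt a₀) (muLiu ι₁ GramClass.rep)) (line V (repAt a₀) (muLiu ι₁ GramClass.rep)))).H).rhoAt t g (f v)) → s.1.μ = t.1.μ)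
    -- [Liu21, App. D Lem D.1 (1)] AS PRINTED per place at the local data of 𝔯δ′⟦a, μ⟧ — scalar-keyed, UNGUARDED
    (hD1'' : ∀ (F : HodgeCM.CMField) [IsGalois ℚ F] (h6 : 6 ≤ Module.finrank ℚ F) {ι₁ : F →+* ℂ} (V : HodgeCM.HermSpace3 F ι₁) (a : RealScalar F)
      (Φ : CMType F) (hΦ : ι₁ ∈ Φ.1) (μ : Literature.NumberTheory.Automorphic.IdeleClassGroup (F : Type) →ₜ* Circle)
      (hμ : IdeleClassGroup.IsConjugateSymplectic (F : Type) μ) (hw : IdeleClassGroup.HasWeight (F : Type) μ 1)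
      (j : (toThm418Data _ (restOfCharDeltaPrime (Summit.HodgeConjecture.CorCM.DelRec.exists_recordSystem_of_printed (Summit.HodgeConjecture.CorCM.D2Bridge.MuKeyEndDelRecFormLocal.canonicalModel_exists_printed_of_form hDel')) ⟨HodgeCM.CMField.K F⟩ h6 ι₁ ⟨HodgeCM.HermSpace3.Hm V, HodgeCM.HermSpace3.isHermitian V, HodgeCM.HermSpace3.signature_ι₁ V, HodgeCM.HermSpace3.posDef_of_ne V⟩ Φ e₁ (frameD V) (frameD_real V) (frameD_ne V) (ιVE V) (Rep.update ↥(maximalRealSubfield (HodgeCM.CMField.K F)) (imagUnitSq (HodgeCM.CMField.K F)) (Rep.ofLineOf ↥(maximalRealSubfield (HodgeCM.CMField.K F)) (imagUnitSq (HodgeCM.CMField.K F))) (locF ↥(maximalRealSubfield (HodgeCM.CMField.K F)) (imagUnitSq (HodgeCM.CMField.K F)) (realUnit ⟨HodgeCM.CMField.K F⟩ a.1 a.2.1 a.2.2)) (realUnit ⟨HodgeCM.CMField.K F⟩ a.1 a.2.1 a.2.2) rfl) μ hμ hw)).AdmIndex) (v : IsDedekindDomain.HeightOneSpectrum (𝓞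 ↥(maximalRealSubfield (F : Type)))),
      LemD1_1AsPrinted
        (Def411WeilCarriers.localLemD1Data ↥(maximalRealSubfield (F : Type)) (F : Type) (IsCMField.complexConj (F : Type)) 3 e₁
          (Matrix.diagonal (frameD V)) (complexConj_imagUnit (F : Type)) (imagUnit_ne_zero (F : Type)) (imagUnit_mul_self (F : Type))
          (realDiagonal_isSymm (F : Type) (frameD V) (frameD_real V)) (isUnit_det_realDiagonal (F : Type) (frameD V) (frameD_real V) (frameD_ne V))
          (realDiagonal_map (F : Type) (frameD V) (frameD_real V)).symm (((Rep.update ↥(maximalRealSubfield (HodgeCM.CMField.K F)) (imagUnitSq (HodgeCM.CMField.K F)) (Rep.ofLineOf ↥(maximalRealSubfield (HodgeCM.CMField.K F)) (imagUnitSq (HodgeCM.CMField.K F))) (locF ↥(maximalRealSubfield (HodgeCM.CMField.K F)) (imagUnitSq (HodgeCM.CMField.K F)) (realUnit ⟨HodgeCM.CMField.K F⟩ a.1 a.2.1 a.2.2)) (realUnit ⟨HodgeCM.CMField.K F⟩ a.1 a.2.1 a.2.2) rfl)).toFun j.1.1)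
          (OmegaChiSplitting.chiLocalSplittingsD ⟨HodgeCM.CMField.K F⟩ e₁ (frameD V) (frameD_real V) (frameD_ne V) (toHeckeCharacter (F : Type) μ)
            ((isOscillatorChar_toHeckeCharacter_iff μ).mpr hμ) (((Rep.update ↥(maximalRealSubfield (HodgeCM.CMField.K F)) (imagUnitSq (HodgeCM.CMField.K F)) (Rep.ofLineOf ↥(maximalRealSubfield (HodgeCM.CMField.K F)) (imagUnitSq (HodgeCM.CMField.K F))) (locF ↥(maximalRealSubfield (HodgeCM.CMField.K F)) (imagUnitSq (HodgeCM.CMField.K F)) (realUnit ⟨HodgeCM.CMField.K F⟩ a.1 a.2.1 a.2.2)) (realUnit ⟨HodgeCM.CMField.K F⟩ a.1 a.2.1 a.2.2) rfl)).toFun j.1.1))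
          (le_refl 3) (localMu (F : Type) (toHeckeCharacter (F : Type) μ))
          (fun v x => norm_localMu (F : Type) (toHeckeCharacter (F : Type) μ) v (isUnitary_toHeckeCharacter (F : Type) μ) x)
          (continuous_localMu (F : Type) (toHeckeCharacter (F : Type) μ))
          (fun v t => localMu_toLocalRing_eq_one_iff (F : Type) (toHeckeCharacter (F : Type) μ) v ((isOscillatorChar_toHeckeCharacter_iff μ).mpr hμ) t)
          j.1.2.1
          (Def411WeilCarriers.norm_chi_eq_one ↥(maximalRealSubfield (F : Type)) (F : Type) (IsCMField.complexConj (F : Type))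
            (Algebra.IsQuadraticExtension.finrank_eq_two ↥(maximalRealSubfield (F : Type)) (F : Type))
            (UnitaryGroup.algEquiv_ne_one_of_apply_eq_neg ↥(maximalRealSubfield (F : Type)) (F : Type) (IsCMField.complexConj (F : Type))
              (complexConj_imagUnit (F : Type)) (imagUnit_ne_zero (F : Type))) j.1.2)
          j.1.2.2.1 v))
    : HC_CM :=
  Summit.HodgeConjecture.CorCM.D2Bridge.MuKeyEnd.hc_cm_of_printed_citations_muKey
    (Summit.HodgeConjecture.CorCM.DelRec.exists_recordSystem_of_printed (Summit.HodgeConjecture.CorCM.D2Bridge.MuKeyEndDelRecFormLocal.canonicalModel_exists_printed_of_form hDel')) h21 hLiuC h411 h413 hμsep hD1''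

end Summit.HodgeConjecture.CorCM.D2Bridge.MuKeyEndDelRecFormLocal

end
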